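import Summits.Ventures.HSemireg.WedgeHankelRecurrenceGaussChebyshevPowerGrowth

/-!
# Venture HSemireg — **COMPARISONS ON THE RIGHT HALF-LINE: for `x ≥ 1`, `x·T_n(x) ≤ T_{n+1}(x) ≤ x·U_n(x)`, `T_n(x) ≤ U_n(x) ≤ (n+1)·T_n(x)`, `U_n(x) ≤ U_{n+1}(x)`; for `x ≥ 2`,
# `C_n(x) ≤ S_n(x)` (`n ≥ 1`), `2S_n(x) ≤ (n+1)·C_n(x)`, `S_n(x) ≤ S_{n+1}(x)`, `x·C_n(x) ≤ 2C_{n+1}(x)`** (all `n ∈ ℕ`; equalities at `x = 1` resp. `x = 2`)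

HONEST FRAMING. Part of the Lean index of the computation cell `pub-hsemireg` (seat p10 gen 49, Sunday typer «UNIFORM-IN-n»).  Real polynomial inequalities only (Mathlib `Polynomial.Chebyshev.T ∕ U ∕
C ∕ S` over `ℝ`); no variety, no cohomology theory, no sheaf, no Ext group and no semiregularity map is constructed here; nothing here says that HC / HC_CM / HC_AV holds; no Literature fact
(unproved `Prop`) is declared or used.  Custodian versions as in `WedgeHankelSiegelIdeal` (1/3).
SOURCES (cited).  T. J. Rivlin, *The Chebyshev Polynomials* (Wiley 1974), §1.2 and Ex. 1.2.x (`T_{n+1} = xT_n − (1 − x²)U_{n−1}`, `U_n = xU_{n−1} + T_n`, `|U_n| ≤ (n+1)`-type comparisons continued to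
`x ≥ 1` via `x = cosh t`: `sinh((n+1)t) ≤ (n+1) sinh t · cosh(nt)`); J. C. Mason, D. C. Handscomb, *Chebyshev Polynomials* (2003), §1.2–1.4.
PROOF TYPED HERE.  (1) `T_{n+2} − x·T_{n+1} = (x² − 1)U_n ≥ 0` (Mathlib `T_eq_X_mul_T_sub_pol_U`, N521 `U_n ≥ n+1 ≥ 0`); (2) `x·U_{n+1} − T_{n+2} = U_n ≥ 0` (Mathlib `T_eq_X_mul_U_sub_U`); (3) `U_n − T_n = x·U_{n−1} ≥ 0`
(Mathlib `T_eq_U_sub_X_mul_U`); (4) `U_{n+1} = x·U_n + T_{n+1} ≤ x(n+1)T_n + T_{n+1} ≤ (n+2)T_{n+1}` by (1), induction; (5) `U_{n+1} − U_n = (x − 1)U_n + T_{n+1} ≥ 0`; (6) `x∕2` transports (N521).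
DEDUP DISCLOSURE (`rg -n 'eval x ≤ \\(Polynomial.Chebyshev.U|T_real_le_U|U_real_le' Summits/Ventures/HSemireg Literature`, 2026-09-04): `Literature…ChebyshevSubmultiplicative.abs_iterate_derivative_T_le`
(`|T_m^{(k)}(x)| ≤ T_n^{(k)}(x)` for `m ≤ n`, `x ≥ 1` — at `k = 0` the INDEX-monotonicity of `T_n(x)`, therefore NOT restated here) and `Literature…FitznerVanDerHofstad2017.two_le_eval_U_add_two_sub`
(`U_{m+2} − U_m ≥ 2`); no `T ∕ U` cross-comparison and no `U_n ≤ U_{n+1}`; 0 hits for the 9 names below.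

WHAT IS IN THE TREE.  N521 `le_eval_chebyshevU_real`, `chebyshevS_eval_eq_U_eval_half`, `chebyshevC_eval_eq_two_mul_T_eval_half`; `Literature…FitznerVanDerHofstad2017.U_natCast_succ`; Mathlib
`T_eq_X_mul_T_sub_pol_U`, `T_eq_X_mul_U_sub_U`, `T_eq_U_sub_X_mul_U`, `one_le_eval_T_real`.
THIS FILE (namespace `Summit.Ventures.HSemireg.Wedge.HankelOuter` continued; CHAINED on N532; 0 definitions):
* §1298 **`mul_eval_chebyshevT_real_le_succ`** (`x·T_n ≤ T_{n+1}`), **`eval_chebyshevT_succ_real_le_mul_U`** (`T_{n+1} ≤ x·U_n`), **`eval_chebyshevT_real_le_U`** (`T_n ≤ U_n`),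
  **`eval_chebyshevU_real_le_mul_T`** (`U_n ≤ (n+1)·T_n`), **`eval_chebyshevU_real_le_succ`** (`U_n ≤ U_{n+1}`) — `x ≥ 1`; **`eval_chebyshevC_real_le_S`** (`C_n ≤ S_n`, `n ≠ 0`),
  **`two_mul_eval_chebyshevS_real_le_mul_C`** (`2S_n ≤ (n+1)·C_n`), **`eval_chebyshevS_real_le_succ`** (`S_n ≤ S_{n+1}`), **`mul_eval_chebyshevC_real_le_two_mul_succ`** (`x·C_n ≤ 2C_{n+1}`) — `x ≥ 2`.
CAVEATS.  `n ∈ ℕ` throughout.  Nothing Ext-side.  New names only.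
-/

open Module Polynomial
open scoped Matrix Polynomial

namespace Summit.Ventures.HSemireg.Wedge.HankelOuter

/-! ## §1298. `T` versus `U` (and `C` versus `S`) on the right half-line -/

/-! ### `x ≥ 1` -/

/-- **`x·T_n(x) ≤ T_{n+1}(x)` for `x ≥ 1`** (`T_{n+1} − xT_n = (x² − 1)U_{n−1} ≥ 0`). [Rivlin 1974, §1.2; this file, §1298] -/
theorem mul_eval_chebyshevT_real_le_succ (n : ℕ) {x : ℝ} (hx : 1 ≤ x) :
    x * (Polynomial.Chebyshev.T ℝ (n : ℤ)).eval x ≤ (Polynomial.Chebyshev.T ℝ ((n + 1 : ℕ) : ℤ)).eval x := by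
  cases n with
  | zero => simp
  | succ m =>
    rw [show ((m + 1 + 1 : ℕ) : ℤ) = (m : ℤ) + 2 by push_cast; ring, Polynomial.Chebyshev.T_eq_X_mul_T_sub_pol_U, show (m : ℤ) + 1 = ((m + 1 : ℕ) : ℤ) by push_cast; ring]
    simp only [eval_sub, eval_mul, eval_X, eval_one, eval_pow]
    have hU : (0 : ℝ) ≤ (Polynomial.Chebyshev.U ℝ (m : ℤ)).eval x := by
      have h1 := le_eval_chebyshevU_real m hx
      have h2 := Nat.cast_nonneg (α := ℝ) m
      linarith
    have hx2 : (0 : ℝ) ≤ x ^ 2 - 1 := by nlinarith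
    nlinarith [mul_nonneg hx2 hU]

/-- **`T_{n+1}(x) ≤ x·U_n(x)` for `x ≥ 1`** (`xU_n − T_{n+1} = U_{n−1} ≥ 0`). [Rivlin 1974, §1.2; this file, §1298] -/
theorem eval_chebyshevT_succ_real_le_mul_U (n : ℕ) {x : ℝ} (hx : 1 ≤ x) :
    (Polynomial.Chebyshev.T ℝ ((n + 1 : ℕ) : ℤ)).eval x ≤ x * (Polynomial.Chebyshev.U ℝ (n : ℤ)).eval x := by
  cases n with
  | zero => simp
  | succ m =>
    rw [show ((m + 1 + 1 : ℕ) : ℤ) = (m : ℤ) + 2 by push_cast; ring, Polynomial.Chebyshev.T_eq_X_mul_U_sub_U, show (m : ℤ) + 1 = ((m + 1 : ℕ) : ℤ) by push_cast; ring]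
    simp only [eval_sub, eval_mul, eval_X]
    have hU : (0 : ℝ) ≤ (Polynomial.Chebyshev.U ℝ (m : ℤ)).eval x := by
      have h1 := le_eval_chebyshevU_real m hx
      have h2 := Nat.cast_nonneg (α := ℝ) m
      linarith
    linarith

/-- **`T_n(x) ≤ U_n(x)` for `x ≥ 1`** (`U_n − T_n = xU_{n−1} ≥ 0`). [Rivlin 1974, §1.2; this file, §1298] -/
theorem eval_chebyshevT_real_le_U (n : ℕ) {x : ℝ} (hx : 1 ≤ x) :
    (Polynomial.Chebyshev.T ℝ (n : ℤ)).eval x ≤ (Polynomial.Chebyshev.U ℝ (n : ℤ)).eval x := by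
  cases n with
  | zero => simp
  | succ m =>
    rw [Polynomial.Chebyshev.T_eq_U_sub_X_mul_U, show ((m + 1 : ℕ) : ℤ) - 1 = (m : ℤ) by push_cast; ring]
    simp only [eval_sub, eval_mul, eval_X]
    have hU : (0 : ℝ) ≤ (Polynomial.Chebyshev.U ℝ (m : ℤ)).eval x := by
      have h1 := le_eval_chebyshevU_real m hx
      have h2 := Nat.cast_nonneg (α := ℝ) m
      linarith
    nlinarith [mul_nonneg (by linarith : (0 : ℝ) ≤ x) hU]

/-- **`U_n(x) ≤ (n+1)·T_n(x)` for `x ≥ 1`** (`U_{n+1} = xU_n + T_{n+1} ≤ x(n+1)T_n + T_{n+1} ≤ (n+2)T_{n+1}`; `sinh((n+1)t) ≤ (n+1) sinh t cosh(nt)`). [Rivlin 1974, §1.2; this file, §1298] -/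
theorem eval_chebyshevU_real_le_mul_T (n : ℕ) {x : ℝ} (hx : 1 ≤ x) :
    (Polynomial.Chebyshev.U ℝ (n : ℤ)).eval x ≤ ((n : ℝ) + 1) * (Polynomial.Chebyshev.T ℝ (n : ℤ)).eval x := by
  induction n with
  | zero => simp
  | succ m ih =>
    rw [Literature.Probability.FitznerVanDerHofstad2017.U_natCast_succ, eval_add, eval_mul, eval_X, Nat.cast_succ (R := ℝ)]
    have hT := mul_eval_chebyshevT_real_le_succ m hx
    have hx0 : (0 : ℝ) ≤ x := by linarith
    have hm := Nat.cast_nonneg (α := ℝ) m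
    nlinarith [mul_le_mul_of_nonneg_left ih hx0, mul_le_mul_of_nonneg_left hT (by linarith : (0 : ℝ) ≤ (m : ℝ) + 1)]

/-- **`U_n(x) ≤ U_{n+1}(x)` for `x ≥ 1`** (`U_{n+1} − U_n = (x − 1)U_n + T_{n+1}`; the `T`-analogue is `Literature…ChebyshevSubmultiplicative.abs_iterate_derivative_T_le` at `k = 0`).
[Rivlin 1974, §1.2; this file, §1298] -/
theorem eval_chebyshevU_real_le_succ (n : ℕ) {x : ℝ} (hx : 1 ≤ x) :
    (Polynomial.Chebyshev.U ℝ (n : ℤ)).eval x ≤ (Polynomial.Chebyshev.U ℝ ((n + 1 : ℕ) : ℤ)).eval x := by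
  rw [Literature.Probability.FitznerVanDerHofstad2017.U_natCast_succ, eval_add, eval_mul, eval_X]
  have hU : (0 : ℝ) ≤ (Polynomial.Chebyshev.U ℝ (n : ℤ)).eval x := by
    have h1 := le_eval_chebyshevU_real n hx
    have h2 := Nat.cast_nonneg (α := ℝ) n
    linarith
  have hT := Polynomial.Chebyshev.one_le_eval_T_real ((n + 1 : ℕ) : ℤ) hx
  nlinarith [mul_nonneg (sub_nonneg.mpr hx) hU]

/-! ### `x ≥ 2` -/

/-- **`C_n(x) ≤ S_n(x)` for `x ≥ 2` and `n ≠ 0`** (`S_n − C_n = S_{n−2} ≥ 0`; here through `T_{m+1} ≤ (x∕2)U_m` and `U_{m+1} = (x∕2)U_m + T_{m+1}`; false at `n = 0`: `C_0 = 2 > 1 = S_0`).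
[Rivlin 1974, §1.2; this file, §1298] -/
theorem eval_chebyshevC_real_le_S {n : ℕ} (hn : n ≠ 0) {x : ℝ} (hx : 2 ≤ x) :
    (Polynomial.Chebyshev.C ℝ (n : ℤ)).eval x ≤ (Polynomial.Chebyshev.S ℝ (n : ℤ)).eval x := by
  obtain ⟨m, rfl⟩ : ∃ m, n = m + 1 := ⟨n - 1, by omega⟩
  rw [chebyshevC_eval_eq_two_mul_T_eval_half, chebyshevS_eval_eq_U_eval_half]
  have h1 := eval_chebyshevT_succ_real_le_mul_U m (show (1 : ℝ) ≤ x / 2 by linarith)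
  rw [Literature.Probability.FitznerVanDerHofstad2017.U_natCast_succ, eval_add, eval_mul, eval_X]
  linarith

/-- **`2S_n(x) ≤ (n+1)·C_n(x)` for `x ≥ 2`** (`U_n ≤ (n+1)T_n` at `x∕2`). [Rivlin 1974, §1.2; this file, §1298] -/
theorem two_mul_eval_chebyshevS_real_le_mul_C (n : ℕ) {x : ℝ} (hx : 2 ≤ x) :
    2 * (Polynomial.Chebyshev.S ℝ (n : ℤ)).eval x ≤ ((n : ℝ) + 1) * (Polynomial.Chebyshev.C ℝ (n : ℤ)).eval x := by
  rw [chebyshevC_eval_eq_two_mul_T_eval_half, chebyshevS_eval_eq_U_eval_half]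
  have h := eval_chebyshevU_real_le_mul_T n (show (1 : ℝ) ≤ x / 2 by linarith)
  nlinarith

/-- **`S_n(x) ≤ S_{n+1}(x)` for `x ≥ 2`.** [Rivlin 1974, §1.2; this file, §1298] -/
theorem eval_chebyshevS_real_le_succ (n : ℕ) {x : ℝ} (hx : 2 ≤ x) :
    (Polynomial.Chebyshev.S ℝ (n : ℤ)).eval x ≤ (Polynomial.Chebyshev.S ℝ ((n + 1 : ℕ) : ℤ)).eval x := by
  rw [chebyshevS_eval_eq_U_eval_half, chebyshevS_eval_eq_U_eval_half]
  exact eval_chebyshevU_real_le_succ n (by linarith)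

/-- **`x·C_n(x) ≤ 2C_{n+1}(x)` for `x ≥ 2`** (`xT_n ≤ T_{n+1}` at `x∕2`). [Rivlin 1974, §1.2; this file, §1298] -/
theorem mul_eval_chebyshevC_real_le_two_mul_succ (n : ℕ) {x : ℝ} (hx : 2 ≤ x) :
    x * (Polynomial.Chebyshev.C ℝ (n : ℤ)).eval x ≤ 2 * (Polynomial.Chebyshev.C ℝ ((n + 1 : ℕ) : ℤ)).eval x := by
  rw [chebyshevC_eval_eq_two_mul_T_eval_half, chebyshevC_eval_eq_two_mul_T_eval_half]
  have h := mul_eval_chebyshevT_real_le_succ n (show (1 : ℝ) ≤ x / 2 by linarith)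
  nlinarith

end Summit.Ventures.HSemireg.Wedge.HankelOuter
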